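import Summits.QuantumFields.YangMills.Theorems.BalabanUVNodesN15KingModelEffectiveLaplacianContinuumLimit
import Summits.QuantumFields.YangMills.Theorems.BalabanUVNodesN15KingModelFreeRGGaussNorm

/-!
# BalabanUVNodes ∕ N15 — THE KING-MODEL RUNG (PART Ϡ-k): THE BLOCK-SPIN IMAGES OF THE FREE FIELD CONVERGE AS MEASURES — THE GAUSSIAN UNIT-LATTICE DENSITIES
# `ρ_K ∝ e^{−½⟨ψ, Δ^{(K)}ψ⟩}` CONVERGE POINTWISE, WITH THEIR NORMALISATIONS AND ALL EXPONENTIAL MOMENTS, TO THE GAUSSIAN `ρ_∞ ∝ e^{−½⟨ψ, Δ^{(∞)}ψ⟩}` WITH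
# COVARIANCE `C^{(∞)} = (Δ^{(∞)})⁻¹`: `∫ e^{⟨J,ψ⟩}ρ_K → ∫ e^{⟨J,ψ⟩}ρ_∞ = e^{½⟨J, C^{(∞)}J⟩}` FOR EVERY SOURCE `J`
# (Track A, DAG node N15 = NE2; FAN-OUT v1.1 §N15 s3 «KING-MODEL RUNG … NE2's analogue DECIDED in the model»)

HONEST FRAMING.  Count-neutral (cell `pub-ymgap`, seat `pub-ymgap-dag-n15-e` g32; `--supports stmt-QuantumFields-27366 --as helper` = K3⁸
`SpineGivenEndpointR13SepCoPHV`).  TEMPLATE LITERATURE: C. King, *The U(1) Higgs model. I. The continuum limit*, Commun. Math. Phys. **102** (1986) 649–677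
[King1986] — KING's OWN `A = 0` MODEL: the Gaussian renormalization transformation (2.4)–(2.6)∕(2.10)–(2.14) pp. 652–653 whose `K`-fold image of the fine
free field is the unit-lattice Gaussian with precision `Δ^{(K)}` (the rung's parts Τ-a∕Τ-i: `FreeField.gaussNorm`, `integral_exp_dot_gaussDensity`,
`exp_neg_kingFreeS_succ`), Theorem 2.1 (i) (2.22) p. 654 «∃ lim_{K→∞} Z^{ε_K}(T_{ε_K}, g, h)» and Theorem 3.4 (3.9) p. 656 «two models on the same unit lattice»,
here with SOURCES `J` on the unit lattice at `g = 0`.  NOT Bałaban's objects; NOT a node discharge (N15 is booked through n15-a's knit, untouched here); nothing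
continuum-Yang–Mills ∕ ℝ⁴ ∕ OS ∕ mass-gap ∕ Clay.  0 `sorry`; standard axioms; 0 `def`.

THE MATHEMATICS.  Part Ϡ-g: `Δ^{(K)}(b,b′) → Δ^{(∞)}(b,b′)` entrywise, `Δ^{(∞)}` symmetric and uniformly coercive, `(Δ^{(∞)})⁻¹ = C^{(∞)}`; part Τ-a: for a symmetric
coercive precision `Δ`, `∫ e^{⟨J,x⟩}e^{−½⟨x,Δx⟩}dx∕𝒩(Δ) = e^{½⟨J,Δ⁻¹J⟩}`.  Along King's run the precisions `Δ^{(K)}` (`K ≥ 1`) are coercive with ONE constant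
`δ_∞ = (a_∞⁻¹ + m⁻²)⁻¹` (`a_K ≥ a_∞`), so `e^{−½⟨ψ,Δ^{(K)}ψ⟩} ≤ e^{−½δ_∞|ψ|²}` is an integrable majorant and dominated convergence gives `𝒩(Δ^{(K)}) → 𝒩(Δ^{(∞)})`
(§2) — Thm 3.4's normalisation comparison (3.93) with the limit identified; the densities converge pointwise (§3); and the exponential moments, being
`e^{½⟨J,(Δ^{(K)})⁻¹J⟩}` exactly, converge to `e^{½⟨J,C^{(∞)}J⟩} = ∫e^{⟨J,ψ⟩}ρ_∞` (§4): the unit-lattice block fields of the free massive field converge in law (all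
exponential moments, every source) to the Gaussian field with King's continuum action `½⟨ψ,Δ^{(∞)}ψ⟩` — Thm 2.1 (i) for the free field WITH unit-lattice sources,
limit in closed form.

WHAT THIS FILE PROVES (kernel).  §1 `effLaplacianLim_symm`, `effLaplacianLim_transpose_eq`, `coercive_effLaplacianLim`, `coercive_effLaplacian_unif` (one `δ_∞` for all
`K ≥ 1`), `tendsto_quadForm_effLaplacian`, `tendsto_quadForm_blockCov`.  §2 ★★ **`tendsto_gaussNorm_effLaplacian`** (`𝒩(Δ^{(K)}) → 𝒩(Δ^{(∞)})`).  §3 ★★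
**`tendsto_gaussDensity_effLaplacian`** (`ρ_K(ψ) → ρ_∞(ψ)` every `ψ`), `integral_gaussDensity_lim` (`∫ρ_∞ = 1`).  §4 ★★★ **`mgf_blockField_eq`** (`∫e^{⟨J,ψ⟩}ρ_K =
e^{½⟨J,(Δ^{(K)})⁻¹J⟩}`), ★★★ **`mgf_lim_eq`** (`∫e^{⟨J,ψ⟩}ρ_∞ = e^{½⟨J,C^{(∞)}J⟩}`), ★★★ **`tendsto_mgf_blockField`** (`∫e^{⟨J,ψ⟩}ρ_K → ∫e^{⟨J,ψ⟩}ρ_∞`, every `J`).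

HONEST SCOPE.  King's `A = 0` FREE model on a finite unit torus, odd `L ≥ 2`, `a, m² > 0`; sources on the unit lattice only (King's `h` lives on the fine lattice —
its block-field marginal is what is treated); the interacting model, `d`-dependence of couplings, and Bałaban's covariant objects are not touched.  N15 untouched;
counts unmoved.  Locators: [King1986] (2.4)–(2.6) p.652, (2.10)–(2.16) p.653, Thm 2.1 (2.22) p.654, Thm 3.4 (3.9) p.656, (3.89)–(3.93) pp.668–669, (4.5) p.670.
-/

noncomputable section

open scoped BigOperators
open Finset Matrix Filter Topology MeasureTheory

namespace Summit.QuantumFields.YangMills.BalabanUVNodes.N15KingModelRung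

open Literature.MathematicalPhysics.QuantumFieldTheory.Balaban1983to89.B5Prop11Plancherel (Tor fine chi sOf conj_chi)
open Literature.MathematicalPhysics.QuantumFieldTheory.Balaban1983to89.QGQInverse (Coercive)
open Literature.MathematicalPhysics.QuantumFieldTheory.King1986 (aK aK_pos)
open Literature.MathematicalPhysics.QuantumFieldTheory.King1986.Torus
open Summit.QuantumFields.YangMills.BalabanUVNodes.N15KingModelRung.FreeField (gaussNorm gaussNorm_pos integrable_gauss integral_exp_dot_gaussDensity
  integral_gaussDensity coercive_scalar quad_scalar)

variable {d : ℕ}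

section Measure

variable (L : ℕ) (M : Fin (d + 1) → ℕ) [hM : ∀ μ, NeZero (M μ)]

/-! ## §1 Letters: symmetry, uniform coercivity, convergence of the quadratic forms -/

/-- `Δ^{(∞)}` is symmetric. [cite: King1986, (2.14) p.653, (4.5) p.670] -/
theorem effLaplacianLim_symm (a m2 : ℝ) (b b' : Tor M) : effLaplacianLim L M a m2 b b' = effLaplacianLim L M a m2 b' b := by
  unfold effLaplacianLim
  have hre : ∀ q : Tor M, (chi M q (b' - b)).re = (chi M q (b - b')).re := fun q => by
    rw [show b - b' = -(b' - b) by abel, ← chi_neg_left, ← conj_chi, Complex.conj_re]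
  simp_rw [hre]

/-- `(Δ^{(∞)})ᵀ = Δ^{(∞)}` as matrices. [cite: King1986, (2.14) p.653] -/
theorem effLaplacianLim_transpose_eq (a m2 : ℝ) :
    (Matrix.of fun b b' => effLaplacianLim L M a m2 b b')ᵀ = Matrix.of fun b b' => effLaplacianLim L M a m2 b b' := by
  ext b b'
  rw [Matrix.transpose_apply, Matrix.of_apply, Matrix.of_apply]
  exact effLaplacianLim_symm L M a m2 b' b

/-- `Δ^{(∞)}` is coercive with `γ_∞ = a_∞∕(1 + a_∞B)` (part Ϡ-g). [cite: King1986, (4.33) p.674] -/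
theorem coercive_effLaplacianLim (hLodd : Odd L) (hL : 2 ≤ L) {a m2 : ℝ} (ha : 0 < a) (hm : 0 < m2) :
    Coercive (Matrix.of fun b b' => effLaplacianLim L M a m2 b b')
      (aInf a L / (1 + aInf a L * ((Real.pi / 2) ^ (2 * (d + 1)) * Real.pi ^ (d + 1) / m2 * (1 + 4 / Real.pi) ^ (d + 1)))) :=
  fun φ => effLaplacianLim_coercive L M hLodd hL ha hm φ

/-- ONE COERCIVITY CONSTANT ALONG THE RUN: `Δ^{(K)} ≥ δ_∞ := (a_∞⁻¹ + m⁻²)⁻¹` for every `K ≥ 1` (`a_K ≥ a_∞`; the tree's `effLaplacian_coercive`).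
[cite: King1986, (2.16) p.653, (4.33) p.674] -/
theorem coercive_effLaplacian_unif (hL : 2 ≤ L) {a m2 : ℝ} (ha : 0 < a) (hm : 0 < m2) {K : ℕ} (hK : 1 ≤ K) :
    haveI : NeZero L := ⟨by omega⟩
    Coercive (effLaplacian (L ^ K) M (aK a L K) (((L ^ K : ℕ) : ℝ) ^ 2) m2) (((aInf a L)⁻¹ + m2⁻¹)⁻¹) := by
  haveI : NeZero L := ⟨by omega⟩
  have hL1 : (1 : ℝ) < L := by exact_mod_cast (show 1 < L by omega)
  have hN1 : 1 ≤ L ^ K := Nat.one_le_pow _ _ (by omega)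
  have haK := aK_pos ha hL1 hK
  have hc := effLaplacian_coercive (L ^ K) M hN1 haK hm
  have hinf := aInf_pos ha hL1
  have hle : ((aInf a L)⁻¹ + m2⁻¹)⁻¹ ≤ ((aK a L K)⁻¹ + m2⁻¹)⁻¹ := by
    apply inv_anti₀ (by positivity)
    have : (aK a L K)⁻¹ ≤ (aInf a L)⁻¹ := inv_anti₀ hinf (aInf_le_aK ha hL1 hK)
    linarith
  intro φ
  have h0 : 0 ≤ φ ⬝ᵥ φ := Finset.sum_nonneg fun i _ => mul_self_nonneg (φ i)
  exact (mul_le_mul_of_nonneg_right hle h0).trans (hc φ)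

/-- The quadratic forms converge: `⟨ψ, Δ^{(K)}ψ⟩ → ⟨ψ, Δ^{(∞)}ψ⟩`. [cite: King1986, Thm 3.4 (3.9) p.656, (2.14) p.653] -/
theorem tendsto_quadForm_effLaplacian (hLodd : Odd L) (hL : 2 ≤ L) {a m2 : ℝ} (ha : 0 < a) (hm : 0 < m2) (ψ : Tor M → ℝ) :
    haveI : NeZero L := ⟨by omega⟩
    Tendsto (fun K : ℕ => ψ ⬝ᵥ (effLaplacian (L ^ K) M (aK a L K) (((L ^ K : ℕ) : ℝ) ^ 2) m2 *ᵥ ψ)) atTop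
      (𝓝 (ψ ⬝ᵥ ((Matrix.of fun b b' => effLaplacianLim L M a m2 b b') *ᵥ ψ))) := by
  haveI : NeZero L := ⟨by omega⟩
  simp only [dotProduct, Matrix.mulVec, Matrix.of_apply]
  exact tendsto_finsetSum _ fun b _ => (tendsto_finsetSum _ fun b' _ => (tendsto_effLaplacian L M hLodd hL ha hm b b').mul_const _).const_mul _

/-- The covariance forms converge: `⟨J, (Δ^{(K)})⁻¹J⟩ → ⟨J, C^{(∞)}J⟩`. [cite: King1986, Thm 2.1 (2.22) p.654, (2.14) p.653] -/
theorem tendsto_quadForm_blockCov (hLodd : Odd L) (hL : 2 ≤ L) {a m2 : ℝ} (ha : 0 < a) (hm : 0 < m2) (J : Tor M → ℝ) :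
    haveI : NeZero L := ⟨by omega⟩
    Tendsto (fun K : ℕ => J ⬝ᵥ ((effLaplacian (L ^ K) M (aK a L K) (((L ^ K : ℕ) : ℝ) ^ 2) m2)⁻¹ *ᵥ J)) atTop
      (𝓝 (J ⬝ᵥ ((Matrix.of fun b b' => blockCovLim L M a m2 b b') *ᵥ J))) := by
  haveI : NeZero L := ⟨by omega⟩
  simp only [dotProduct, Matrix.mulVec, Matrix.of_apply]
  exact tendsto_finsetSum _ fun b _ => (tendsto_finsetSum _ fun b' _ => (tendsto_blockCov L M hLodd hL ha hm b b').mul_const _).const_mul _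

/-! ## §2 The normalisations converge -/

/-- ★★ **`𝒩(Δ^{(K)}) → 𝒩(Δ^{(∞)})`** (`L` odd `≥ 2`, `a, m² > 0`, every unit torus): dominated convergence on `ℝ^Ω` with the majorant `e^{−½δ_∞|ψ|²}` — Thm 3.4's
normalisation comparison (3.93) for the free field, with the limit identified. [cite: King1986, (3.89)–(3.93) pp.668–669, Thm 3.4 (3.9) p.656] -/
theorem tendsto_gaussNorm_effLaplacian (hLodd : Odd L) (hL : 2 ≤ L) {a m2 : ℝ} (ha : 0 < a) (hm : 0 < m2) :
    haveI : NeZero L := ⟨by omega⟩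
    Tendsto (fun K : ℕ => gaussNorm (effLaplacian (L ^ K) M (aK a L K) (((L ^ K : ℕ) : ℝ) ^ 2) m2)) atTop
      (𝓝 (gaussNorm (Matrix.of fun b b' => effLaplacianLim L M a m2 b b'))) := by
  haveI : NeZero L := ⟨by omega⟩
  have hL1 : (1 : ℝ) < L := by exact_mod_cast (show 1 < L by omega)
  set δ := ((aInf a L)⁻¹ + m2⁻¹)⁻¹ with hδdef
  have hδ : 0 < δ := by have := aInf_pos ha hL1; positivity
  unfold gaussNorm
  refine tendsto_integral_filter_of_dominated_convergence (fun x : Tor M → ℝ => Real.exp (-(1 / 2 : ℝ) * (x ⬝ᵥ ((δ • (1 : Matrix (Tor M) (Tor M) ℝ)) *ᵥ x))))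
    ?_ ?_ (integrable_gauss hδ (coercive_scalar δ)) ?_
  · exact Eventually.of_forall fun K => (Real.continuous_exp.comp (by simp only [dotProduct, Matrix.mulVec]; fun_prop)).aestronglyMeasurable
  · filter_upwards [eventually_ge_atTop 1] with K hK
    refine Eventually.of_forall fun x => ?_
    rw [Real.norm_eq_abs, abs_of_pos (Real.exp_pos _)]
    have hc := coercive_effLaplacian_unif L M hL ha hm hK x
    rw [quad_scalar]
    have hxx : x ⬝ᵥ x = ∑ i, x i ^ 2 := by simp [dotProduct, sq]
    rw [hxx] at hc
    exact Real.exp_le_exp.mpr (by nlinarith)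
  · exact Eventually.of_forall fun x => (Real.continuous_exp.tendsto _).comp ((tendsto_quadForm_effLaplacian L M hLodd hL ha hm x).const_mul _)

/-! ## §3 The densities converge pointwise; the limit is a probability density -/

/-- ★★ **THE UNIT-LATTICE GAUSSIAN DENSITIES CONVERGE POINTWISE**: `ρ_K(ψ) = e^{−½⟨ψ,Δ^{(K)}ψ⟩}∕𝒩(Δ^{(K)}) → ρ_∞(ψ) = e^{−½⟨ψ,Δ^{(∞)}ψ⟩}∕𝒩(Δ^{(∞)})` for every `ψ`.
[cite: King1986, (2.6) p.652, (2.14) p.653, Thm 3.4 (3.9) p.656] -/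
theorem tendsto_gaussDensity_effLaplacian (hLodd : Odd L) (hL : 2 ≤ L) {a m2 : ℝ} (ha : 0 < a) (hm : 0 < m2) (ψ : Tor M → ℝ) :
    haveI : NeZero L := ⟨by omega⟩
    Tendsto (fun K : ℕ => Real.exp (-(1 / 2 : ℝ) * (ψ ⬝ᵥ (effLaplacian (L ^ K) M (aK a L K) (((L ^ K : ℕ) : ℝ) ^ 2) m2 *ᵥ ψ)))
        / gaussNorm (effLaplacian (L ^ K) M (aK a L K) (((L ^ K : ℕ) : ℝ) ^ 2) m2)) atTop
      (𝓝 (Real.exp (-(1 / 2 : ℝ) * (ψ ⬝ᵥ ((Matrix.of fun b b' => effLaplacianLim L M a m2 b b') *ᵥ ψ)))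
        / gaussNorm (Matrix.of fun b b' => effLaplacianLim L M a m2 b b'))) := by
  haveI : NeZero L := ⟨by omega⟩
  have hL1 : (1 : ℝ) < L := by exact_mod_cast (show 1 < L by omega)
  have hγ := effSymLim_pos (d := d) ha hL1 hm.le
  have hN : 0 < gaussNorm (Matrix.of fun b b' => effLaplacianLim L M a m2 b b') :=
    gaussNorm_pos (by have := aInf_pos ha hL1; positivity) (coercive_effLaplacianLim L M hLodd hL ha hm)
  exact (((Real.continuous_exp.tendsto _).comp ((tendsto_quadForm_effLaplacian L M hLodd hL ha hm ψ).const_mul _)).div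
    (tendsto_gaussNorm_effLaplacian L M hLodd hL ha hm) hN.ne')

/-- `∫ ρ_∞ = 1`: the limit density is a probability density. [cite: King1986, (2.6) p.652] -/
theorem integral_gaussDensity_lim (hLodd : Odd L) (hL : 2 ≤ L) {a m2 : ℝ} (ha : 0 < a) (hm : 0 < m2) :
    ∫ ψ : Tor M → ℝ, Real.exp (-(1 / 2 : ℝ) * (ψ ⬝ᵥ ((Matrix.of fun b b' => effLaplacianLim L M a m2 b b') *ᵥ ψ)))
        / gaussNorm (Matrix.of fun b b' => effLaplacianLim L M a m2 b b') = 1 := by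
  have hL1 : (1 : ℝ) < L := by exact_mod_cast (show 1 < L by omega)
  exact integral_gaussDensity (by have := aInf_pos ha hL1; positivity) (coercive_effLaplacianLim L M hLodd hL ha hm)

/-! ## §4 Exponential moments: exact values and convergence -/

/-- ★★★ **THE MOMENT GENERATING FUNCTION OF THE LEVEL-`K` BLOCK FIELD**: `∫ e^{⟨J,ψ⟩}ρ_K(ψ)dψ = e^{½⟨J,(Δ^{(K)})⁻¹J⟩}` (`K ≥ 1`) — part Τ-a's tilt identity at King's
precision `Δ^{(K)}`; the exponent is NE2's unit-layer kernel's quadratic form. [cite: King1986, (2.6) p.652, (2.14)–(2.16) p.653, (3.4) p.655] -/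
theorem mgf_blockField_eq (hL : 2 ≤ L) {a m2 : ℝ} (ha : 0 < a) (hm : 0 < m2) {K : ℕ} (hK : 1 ≤ K) (J : Tor M → ℝ) :
    haveI : NeZero L := ⟨by omega⟩
    ∫ ψ : Tor M → ℝ, Real.exp (J ⬝ᵥ ψ) * (Real.exp (-(1 / 2 : ℝ) * (ψ ⬝ᵥ (effLaplacian (L ^ K) M (aK a L K) (((L ^ K : ℕ) : ℝ) ^ 2) m2 *ᵥ ψ)))
        / gaussNorm (effLaplacian (L ^ K) M (aK a L K) (((L ^ K : ℕ) : ℝ) ^ 2) m2))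
      = Real.exp ((1 / 2 : ℝ) * (J ⬝ᵥ ((effLaplacian (L ^ K) M (aK a L K) (((L ^ K : ℕ) : ℝ) ^ 2) m2)⁻¹ *ᵥ J))) := by
  haveI : NeZero L := ⟨by omega⟩
  have hL1 : (1 : ℝ) < L := by exact_mod_cast (show 1 < L by omega)
  have hδ : 0 < ((aInf a L)⁻¹ + m2⁻¹)⁻¹ := by have := aInf_pos ha hL1; positivity
  exact integral_exp_dot_gaussDensity hδ (coercive_effLaplacian_unif L M hL ha hm hK) (effLaplacian_transpose_eq (L ^ K) M _ _ _) J

/-- ★★★ **THE MOMENT GENERATING FUNCTION OF THE LIMIT FIELD**: `∫ e^{⟨J,ψ⟩}ρ_∞(ψ)dψ = e^{½⟨J, C^{(∞)}J⟩}` with `C^{(∞)} = blockCovLim` EXPLICIT (`(Δ^{(∞)})⁻¹ = C^{(∞)}`,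
part Ϡ-g). [cite: King1986, (2.6) p.652, (2.14)–(2.16) p.653, Thm 2.1 (2.22) p.654] -/
theorem mgf_lim_eq (hLodd : Odd L) (hL : 2 ≤ L) {a m2 : ℝ} (ha : 0 < a) (hm : 0 < m2) (J : Tor M → ℝ) :
    ∫ ψ : Tor M → ℝ, Real.exp (J ⬝ᵥ ψ) * (Real.exp (-(1 / 2 : ℝ) * (ψ ⬝ᵥ ((Matrix.of fun b b' => effLaplacianLim L M a m2 b b') *ᵥ ψ)))
        / gaussNorm (Matrix.of fun b b' => effLaplacianLim L M a m2 b b'))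
      = Real.exp ((1 / 2 : ℝ) * (J ⬝ᵥ ((Matrix.of fun b b' => blockCovLim L M a m2 b b') *ᵥ J))) := by
  have hL1 : (1 : ℝ) < L := by exact_mod_cast (show 1 < L by omega)
  have h := integral_exp_dot_gaussDensity (by have := aInf_pos ha hL1; positivity) (coercive_effLaplacianLim L M hLodd hL ha hm)
    (effLaplacianLim_transpose_eq L M a m2) J
  rw [h, ← blockCovLim_eq_inv L M hLodd hL ha hm]

/-- ★★★ **THE BLOCK FIELDS CONVERGE IN LAW (ALL EXPONENTIAL MOMENTS)**: for `L` odd `≥ 2`, `a, m² > 0`, every unit torus `Ω` and EVERY source `J : Ω → ℝ`,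
`∫ e^{⟨J,ψ⟩}ρ_K(ψ)dψ → ∫ e^{⟨J,ψ⟩}ρ_∞(ψ)dψ` as `K → ∞` — the `K`-fold block-spin images of the fine-lattice free massive fields converge to the Gaussian unit-lattice field
with King's continuum action `½⟨ψ, Δ^{(∞)}ψ⟩` (Thm 2.1 (i) with unit-lattice sources, free field, limit in closed form). [cite: King1986, Thm 2.1 (2.22) p.654, Thm 3.4 (3.9) p.656, (2.14) p.653] -/
theorem tendsto_mgf_blockField (hLodd : Odd L) (hL : 2 ≤ L) {a m2 : ℝ} (ha : 0 < a) (hm : 0 < m2) (J : Tor M → ℝ) :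
    haveI : NeZero L := ⟨by omega⟩
    Tendsto (fun K : ℕ => ∫ ψ : Tor M → ℝ, Real.exp (J ⬝ᵥ ψ)
        * (Real.exp (-(1 / 2 : ℝ) * (ψ ⬝ᵥ (effLaplacian (L ^ K) M (aK a L K) (((L ^ K : ℕ) : ℝ) ^ 2) m2 *ᵥ ψ)))
          / gaussNorm (effLaplacian (L ^ K) M (aK a L K) (((L ^ K : ℕ) : ℝ) ^ 2) m2))) atTop
      (𝓝 (∫ ψ : Tor M → ℝ, Real.exp (J ⬝ᵥ ψ) * (Real.exp (-(1 / 2 : ℝ) * (ψ ⬝ᵥ ((Matrix.of fun b b' => effLaplacianLim L M a m2 b b') *ᵥ ψ)))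
          / gaussNorm (Matrix.of fun b b' => effLaplacianLim L M a m2 b b')))) := by
  haveI : NeZero L := ⟨by omega⟩
  rw [mgf_lim_eq L M hLodd hL ha hm J]
  have hlim : Tendsto (fun K : ℕ => Real.exp ((1 / 2 : ℝ) * (J ⬝ᵥ ((effLaplacian (L ^ K) M (aK a L K) (((L ^ K : ℕ) : ℝ) ^ 2) m2)⁻¹ *ᵥ J)))) atTop
      (𝓝 (Real.exp ((1 / 2 : ℝ) * (J ⬝ᵥ ((Matrix.of fun b b' => blockCovLim L M a m2 b b') *ᵥ J))))) :=
    (Real.continuous_exp.tendsto _).comp ((tendsto_quadForm_blockCov L M hLodd hL ha hm J).const_mul _)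
  refine hlim.congr' ?_
  filter_upwards [eventually_ge_atTop 1] with K hK
  exact (mgf_blockField_eq L M hL ha hm hK J).symm

end Measure

end Summit.QuantumFields.YangMills.BalabanUVNodes.N15KingModelRung

end
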